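import Literature.MathematicalPhysics.QuantumFieldTheory.Balaban1983to89.T4BetaMemory
import HarnessLib

/-!
# NE7MarginalL1Supply — route ℓ¹ of the NE7 crux, the SUPPLIER side: what an η-row must deliver for «the along-the-run β-shift is ℓ¹» —
# the ℓ¹ RENEWAL (forward, summed) and «summable one-step sources + fading functional memory ⇒ summable shifts» (ℓ¹ twin of
# `T4BetaMemory.remainderShiftRate_of_memory`); the one-loop∕remainder split in ℓ¹ currency

Cell `pub-balaban`, rung (B)+1 sub-cell t4, lineage `b2b-balaban-t4-ne7-p1`, generation 28 (CRUX PROVER NE7 #1, ruling e34b3e0c item (2)); route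
ℓ¹ = `t4/ROUTES-NE7.md` §L2.1 (rank 1 → t4-ne7-p1; cell C-L1°), step A3 «the input that remains» and its announced S-sized bookkeeping («the ℓ¹ twin
of `T4BetaMemory.remainderShiftRate_of_memory` … ℓ¹ renewal, statement shape `NE7Lens2.L1RenewalStatement`»); companions `NE7MarginalL1Currency`
(shapes + node U6's side), `NE7MarginalL1Runs` (node U2's side).  HONEST FRAMING (page 1): FIXED FINITE T⁴, rung (B)+1; NE7 NOT PRINTED in
[Balaban1984PropagatorsI]–[Balaban1989LargeFieldII], NOT PROVED here; continuum YM on T⁴ ⇐ BetaPertH ∧ nine spine estimates (0/9 proved); BetaPertH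
⇐ (D1) ∧ (D4) ∧ CAP+tail; G-an2-4 gates asym, D1 and NE2/3/4; NOT infinite volume, NOT mass gap, NOT Clay.

WHAT.  In the geometric currency the tree reduces node U2's `RemainderShiftRate S c₁ θ γ` to ONE-STEP SOURCES + FADING FUNCTIONAL MEMORY +
smallness (`T4BetaMemory.remainderShiftRate_of_memory`: `DataRenewal src′ M′ s` with `src′_j ≤ aρ^j`, `ShiftDecomposition S γ src M s` with
`src_k ≤ bρ^k`, memories `≤ C ω^{age}`, `(1 + C′)ω < ρ`).  This file is the ℓ¹ twin, with NO rate anywhere: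
§1 **`l1Renewal`** — `DataRenewal src′ M′ s`, `FadingMemory C′ ω M′`, `(1 + C′)ω < 1`, `s ≥ 0` ⇒ `Σ_{j<N} s_j ≤ (1−ω)(1−(1+C′)ω)⁻¹·Σ_{j<N} src′_j`
   for every `N` (the lens-2 statement shape `L1RenewalStatement`, PROVED: sum the recursion over `j < N` and exchange — the memory's column sums
   are `≤ C′ω(1−ω)⁻¹`); **`summable_of_dataRenewal`** — hence `Summable src′ ⇒ Summable s` (`src′ ≥ 0`).
§2 `memSum_partial_le` — `Σ_{k<N} Σ_{i<k} M_{k,i}s_i ≤ Cω(1−ω)⁻¹·Σ_{i<N} s_i` under `FadingMemory C ω M`, `s ≥ 0`; **`summable_shiftMajorant`** — the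
   displayed majorant `k ↦ src k + Σ_{i<k} M_{k,i}s_i` of `ShiftDecomposition` is summable as soon as `src`, `s` are (`src, s ≥ 0`).
§3 **`remainderShift_l1_of_memory`** — `ShiftDecomposition S γ src M s` + `DataRenewal src′ M′ s` + both memories fading at rate `ω` + `(1 + C′)ω < 1`
   + `Summable src`, `Summable src′` ⇒ the remainder's two-depth shift is bounded ON THE WHOLE BOX by a nonnegative SUMMABLE sequence — hence along
   every run (the companion's `ShiftAlongRun` for the remainder); **`shift_le_of_split`** — the full β-shift along a run is at most the one-loop
   increment `|β⁰_{k+1} − β⁰_k|` plus the remainder's shift (`B12Beta.OneLoopSplit.split`), so the question asked of the β-cell changes from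
   «geometric convergence of b₀(k)» to «`Σ_k |b₀(k+1) − b₀(k)| < ∞`» (`t4/ROUTES-NE7.md` §L2.1, CONSTANTS line); **`shiftAlong_of_split_l1`** — both ℓ¹
   ⇒ the along-run shift sequence is ℓ¹.
§4 `shiftAlong_of_scaleShiftRate` ∕ `remainderShift_l1_of_rate` — the tree's GEOMETRIC node-U2 inputs (`ScaleShiftRate`, `RemainderShiftRate`) are the
   special case `σ_j = cθ^j` of the ℓ¹ supplier shapes: every existing producer feeds the ℓ¹ road unchanged (geometric ⊂ ℓ¹ at the supplier level).
HONEST: every hypothesis SHAPE here (`ShiftDecomposition`, `DataRenewal`, `FadingMemory`) is an UNPRINTED structural input of the tree (row T4-U2.R;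
[Balaban1987RG1] (2.12)–(2.15) p. 268 read structurally; no modulus is printed); the comparison content of WALL §3 (γ2)∕(γ3) is NOT removed — it is
re-denominated: summable one-step source rates instead of geometric ones.  [folklore] bookkeeping; 0 def, 0 sorry; NE7 NOT proved.
-/

noncomputable section

open Finset

namespace Summit.QuantumFields.BalabanUV.T4Continuum.NE7MarginalL1Supply

open Literature.MathematicalPhysics.QuantumFieldTheory.Balaban1983to89
open Literature.MathematicalPhysics.QuantumFieldTheory.Balaban1983to89.FlowStep
open T4CouplingMatching (FadingMemory)
open T4BetaMemory (ShiftDecomposition DataRenewal)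

/-! ## §1 The ℓ¹ renewal: partial sums of a fading-memory recursion are dominated by the partial sums of its sources -/

/-- COLUMN SUMS OF A FADING MEMORY: for `s ≥ 0`, `FadingMemory C ω M` (`0 ≤ ω < 1`, `C ≥ 0`):
`Σ_{j<N} Σ_{i<j} M_{j,i}·s_i ≤ C·ω·(1−ω)⁻¹·Σ_{i<N} s_i` (exchange; each column `Σ_{j>i} ω^{j−i} ≤ ω(1−ω)⁻¹`). [folklore] -/
theorem memSum_partial_le {M : ℕ → ℕ → ℝ} {C ω : ℝ} {s : ℕ → ℝ} (hM : FadingMemory C ω M) (hC : 0 ≤ C) (hω0 : 0 ≤ ω) (hω1 : ω < 1)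
    (hs : ∀ i, 0 ≤ s i) (N : ℕ) :
    ∑ j ∈ range N, ∑ i ∈ range j, M j i * s i ≤ C * ω * (1 - ω)⁻¹ * ∑ i ∈ range N, s i := by
  have h1ω : 0 < 1 - ω := by linarith
  have hex : ∑ j ∈ range N, ∑ i ∈ range j, M j i * s i = ∑ i ∈ range N, ∑ j ∈ Ico (i + 1) N, M j i * s i := by
    refine Finset.sum_comm' ?_
    intro j i
    simp only [mem_range, mem_Ico]
    omega
  rw [hex, Finset.mul_sum]
  refine Finset.sum_le_sum fun i _ => ?_
  have hcol : ∑ j ∈ Ico (i + 1) N, M j i ≤ C * ω * (1 - ω)⁻¹ := by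
    calc ∑ j ∈ Ico (i + 1) N, M j i ≤ ∑ j ∈ Ico (i + 1) N, C * ω ^ (j - i) :=
          Finset.sum_le_sum fun j hj => (hM j i (by have := (mem_Ico.mp hj).1; omega)).2
      _ = C * ω * ∑ t ∈ range (N - (i + 1)), ω ^ t := by
          rw [Finset.sum_Ico_eq_sum_range, Finset.mul_sum]
          refine Finset.sum_congr rfl fun t _ => ?_
          have : i + 1 + t - i = t + 1 := by omega
          rw [this, pow_succ]
          ring
      _ ≤ C * ω * (1 - ω)⁻¹ := by
          refine mul_le_mul_of_nonneg_left ?_ (mul_nonneg hC hω0)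
          exact sum_le_hasSum _ (fun m _ => pow_nonneg hω0 m) (hasSum_geometric_of_lt_one hω0 hω1)
  have hM0 : ∀ j ∈ Ico (i + 1) N, 0 ≤ M j i := fun j hj => (hM j i (by have := (mem_Ico.mp hj).1; omega)).1
  calc ∑ j ∈ Ico (i + 1) N, M j i * s i = (∑ j ∈ Ico (i + 1) N, M j i) * s i := by rw [Finset.sum_mul]
    _ ≤ C * ω * (1 - ω)⁻¹ * s i := mul_le_mul_of_nonneg_right hcol (hs i)

/-- **THE ℓ¹ RENEWAL** (lens-2 `L1RenewalStatement`, proved).  `DataRenewal src′ M′ s` (`s_j ≤ src′_j + Σ_{i<j} M′_{j,i}s_i`), `FadingMemory C′ ω M′`,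
`(1 + C′)·ω < 1`, `s ≥ 0` ⇒ for every `N`, `Σ_{j<N} s_j ≤ (1−ω)·(1−(1+C′)ω)⁻¹·Σ_{j<N} src′_j` — the partial sums of the bracket discrepancies are
dominated by those of their one-step sources; NO rate on either side. [folklore] -/
theorem l1Renewal {src' s : ℕ → ℝ} {M' : ℕ → ℕ → ℝ} {C' ω : ℝ} (hren : DataRenewal src' M' s) (hM' : FadingMemory C' ω M')
    (hC' : 0 ≤ C') (hω0 : 0 ≤ ω) (hsmall : (1 + C') * ω < 1) (hs : ∀ i, 0 ≤ s i) (N : ℕ) :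
    ∑ j ∈ range N, s j ≤ (1 - ω) * (1 - (1 + C') * ω)⁻¹ * ∑ j ∈ range N, src' j := by
  have hω1 : ω < 1 := by nlinarith [mul_nonneg hC' hω0]
  have h1ω : 0 < 1 - ω := by linarith
  have hden : 0 < 1 - (1 + C') * ω := by linarith
  have hsum : ∑ j ∈ range N, s j ≤ ∑ j ∈ range N, src' j + ∑ j ∈ range N, ∑ i ∈ range j, M' j i * s i := by
    rw [← Finset.sum_add_distrib]
    exact Finset.sum_le_sum fun j _ => hren j
  have hmem := memSum_partial_le hM' hC' hω0 hω1 hs N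
  -- S ≤ A + C′ω(1−ω)⁻¹ S  ⇒  S·(1 − (1+C′)ω) ≤ A·(1 − ω)
  have hS : (∑ j ∈ range N, s j) * (1 - (1 + C') * ω) ≤ (∑ j ∈ range N, src' j) * (1 - ω) := by
    have h := hsum.trans (add_le_add le_rfl hmem)
    have h' := mul_le_mul_of_nonneg_right h h1ω.le
    have e : C' * ω * (1 - ω)⁻¹ * (∑ i ∈ range N, s i) * (1 - ω) = C' * ω * ∑ i ∈ range N, s i := by
      field_simp
    nlinarith [h', e]
  rw [mul_comm (1 - ω), mul_assoc, ← div_eq_inv_mul, le_div_iff₀ hden]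
  linarith [hS]

/-- **`Summable src′ ⇒ Summable s`** under the ℓ¹ renewal (`s, src′ ≥ 0`), with `Σ s ≤ (1−ω)(1−(1+C′)ω)⁻¹·Σ src′`. [folklore] -/
theorem summable_of_dataRenewal {src' s : ℕ → ℝ} {M' : ℕ → ℕ → ℝ} {C' ω : ℝ} (hren : DataRenewal src' M' s)
    (hM' : FadingMemory C' ω M') (hC' : 0 ≤ C') (hω0 : 0 ≤ ω) (hsmall : (1 + C') * ω < 1) (hs : ∀ i, 0 ≤ s i)
    (hsrc0 : ∀ j, 0 ≤ src' j) (hsrc : Summable src') :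
    Summable s ∧ ∑' j, s j ≤ (1 - ω) * (1 - (1 + C') * ω)⁻¹ * ∑' j, src' j := by
  have hω1 : ω < 1 := by nlinarith [mul_nonneg hC' hω0]
  have hK0 : 0 ≤ (1 - ω) * (1 - (1 + C') * ω)⁻¹ := mul_nonneg (by linarith) (inv_nonneg.mpr (by linarith))
  have hbound : ∀ N, ∑ j ∈ range N, s j ≤ (1 - ω) * (1 - (1 + C') * ω)⁻¹ * ∑' j, src' j := fun N =>
    (l1Renewal hren hM' hC' hω0 hsmall hs N).trans
      (mul_le_mul_of_nonneg_left (hsrc.sum_le_tsum (range N) fun j _ => hsrc0 j) hK0)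
  exact ⟨summable_of_sum_range_le hs hbound, (summable_of_sum_range_le hs hbound).tsum_le_of_sum_range_le hbound⟩

/-! ## §2 The shift majorant of `ShiftDecomposition` is summable when its sources and data are -/

/-- The displayed majorant `k ↦ src k + Σ_{i<k} M_{k,i}·s_i` of `T4BetaMemory.ShiftDecomposition` has partial sums
`≤ Σ_{k<N} src_k + Cω(1−ω)⁻¹·Σ_{i<N} s_i`; hence it is SUMMABLE when `src` and `s` are (`src, s ≥ 0`, `FadingMemory C ω M`). [folklore] -/
theorem summable_shiftMajorant {src s : ℕ → ℝ} {M : ℕ → ℕ → ℝ} {C ω : ℝ} (hM : FadingMemory C ω M) (hC : 0 ≤ C) (hω0 : 0 ≤ ω)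
    (hω1 : ω < 1) (hs : ∀ i, 0 ≤ s i) (hsrc0 : ∀ k, 0 ≤ src k) (hsrc : Summable src) (hsum : Summable s) :
    Summable (fun k => src k + ∑ i ∈ range k, M k i * s i) ∧
      ∑' k, (src k + ∑ i ∈ range k, M k i * s i) ≤ ∑' k, src k + C * ω * (1 - ω)⁻¹ * ∑' i, s i := by
  have h1ω : 0 < 1 - ω := by linarith
  have hK0 : 0 ≤ C * ω * (1 - ω)⁻¹ := mul_nonneg (mul_nonneg hC hω0) (inv_nonneg.mpr h1ω.le)
  have hnn : ∀ k, 0 ≤ src k + ∑ i ∈ range k, M k i * s i := fun k =>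
    add_nonneg (hsrc0 k) (Finset.sum_nonneg fun i hi => mul_nonneg (hM k i (mem_range.mp hi).le).1 (hs i))
  have hbound : ∀ N, ∑ k ∈ range N, (src k + ∑ i ∈ range k, M k i * s i) ≤ ∑' k, src k + C * ω * (1 - ω)⁻¹ * ∑' i, s i := by
    intro N
    rw [Finset.sum_add_distrib]
    exact add_le_add (hsrc.sum_le_tsum (range N) fun k _ => hsrc0 k)
      ((memSum_partial_le hM hC hω0 hω1 hs N).trans
        (mul_le_mul_of_nonneg_left (hsum.sum_le_tsum (range N) fun i _ => hs i) hK0))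
  exact ⟨summable_of_sum_range_le hnn hbound, (summable_of_sum_range_le hnn hbound).tsum_le_of_sum_range_le hbound⟩

/-! ## §3 The remainder's two-depth shift in ℓ¹ from sources + memory; the one-loop ∕ remainder split -/

/-- **ℓ¹ TWIN OF `T4BetaMemory.remainderShiftRate_of_memory`.**  Under `ShiftDecomposition S γ src M s` (the remainder's two-depth shift on the box
`≤ src k + Σ_{i<k} M_{k,i}s_i`), `DataRenewal src′ M′ s`, `FadingMemory C ω M`, `FadingMemory C′ ω M′`, `(1 + C′)ω < 1`, nonnegative data and
SUMMABLE one-step sources `src`, `src′`: the remainder's shift is bounded ON THE WHOLE BOX, uniformly in the history, by the nonnegative SUMMABLE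
sequence `σ¹_k := src k + Σ_{i<k} M_{k,i}s_i`.  No rate `ρ`, `θ` anywhere; every hypothesis is an UNPRINTED input (cell NE2∕NE3∕NE5 for the
sources, a modulus form of [Balaban1988Convergent] (2.43) for the memories). [cite: Balaban1987RG1, (2.12)-(2.15) p.268] -/
theorem remainderShift_l1_of_memory {β : HBeta} {S : B12Beta.OneLoopSplit β} {γ C C' ω : ℝ} {src src' s : ℕ → ℝ}
    {M M' : ℕ → ℕ → ℝ} (hC : 0 ≤ C) (hC' : 0 ≤ C') (hω0 : 0 ≤ ω) (hsmall : (1 + C') * ω < 1)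
    (hdec : ShiftDecomposition S γ src M s) (hren : DataRenewal src' M' s) (hM : FadingMemory C ω M) (hM' : FadingMemory C' ω M')
    (hs : ∀ i, 0 ≤ s i) (hsrc0 : ∀ k, 0 ≤ src k) (hsrc'0 : ∀ j, 0 ≤ src' j) (hsrc : Summable src) (hsrc' : Summable src') :
    (∀ k, 0 ≤ src k + ∑ i ∈ range k, M k i * s i) ∧
    Summable (fun k => src k + ∑ i ∈ range k, M k i * s i) ∧
    ∀ k (w : Fin (k + 2) → ℝ), w ∈ Box γ (k + 1) → |S.β1 (k + 1) w - S.β1 k (Fin.tail w)| ≤ src k + ∑ i ∈ range k, M k i * s i := by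
  have hω1 : ω < 1 := by nlinarith [mul_nonneg hC' hω0]
  have hsS : Summable s := (summable_of_dataRenewal hren hM' hC' hω0 hsmall hs hsrc'0 hsrc').1
  refine ⟨fun k => add_nonneg (hsrc0 k) (Finset.sum_nonneg fun i hi => mul_nonneg (hM k i (mem_range.mp hi).le).1 (hs i)),
    (summable_shiftMajorant hM hC hω0 hω1 hs hsrc0 hsrc hsS).1, fun k w hw => hdec k w hw⟩

/-- THE SPLIT ALONG A RUN: with the printed one-loop split `β_{k+1} = β⁰_{k+1} + β¹_{k+1}` (`B12Beta.OneLoopSplit`), the full two-depth β-shift at any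
history `w` is at most the one-loop INCREMENT plus the remainder's shift:
`|β_{k+1}(w) − β_k(tail w)| ≤ |β⁰_{k+1} − β⁰_k| + |β¹_{k+1}(w) − β¹_k(tail w)|`. [cite: Balaban1987RG1, (2.12)-(2.15) p.268] -/
theorem shift_le_of_split {β : HBeta} (S : B12Beta.OneLoopSplit β) (k : ℕ) (w : Fin (k + 2) → ℝ) :
    |β (k + 1) w - β k (Fin.tail w)| ≤ |S.β0 (k + 1) - S.β0 k| + |S.β1 (k + 1) w - S.β1 k (Fin.tail w)| := by
  have e : β (k + 1) w - β k (Fin.tail w) = (S.β0 (k + 1) - S.β0 k) + (S.β1 (k + 1) w - S.β1 k (Fin.tail w)) := by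
    rw [S.split (k + 1) w, S.split k (Fin.tail w)]; ring
  rw [e]
  exact abs_add_le _ _

/-- **THE ALONG-RUN SHIFT IS ℓ¹ FROM: BV ONE-LOOP COEFFICIENTS + ℓ¹ REMAINDER SHIFT.**  If `|β⁰_{k+1} − β⁰_k| ≤ σ⁰_k` (what the β-cell is now asked:
`Σ_k |b₀(k+1) − b₀(k)| < ∞`, i.e. bounded variation of the per-depth one-loop coefficients — weaker than the tree's geometric `conv`) and the
remainder's shift is `≤ σ¹_k` on the box (e.g. `remainderShift_l1_of_memory`), then along EVERY run `g^B` in the box the two-depth β-shift at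
scale `j < K` is `≤ σ⁰_j + σ¹_j` — the companion's `ShiftAlongRun (σ⁰ + σ¹) β g^B K`, written out — and `σ⁰ + σ¹` is summable when both are.
[cite: Balaban1987RG1, (0.20) p.256 and (2.12)-(2.15) p.268] -/
theorem shiftAlong_of_split_l1 {β : HBeta} (S : B12Beta.OneLoopSplit β) {γ : ℝ} {σ0 σ1 : ℕ → ℝ} {K : ℕ} {gB : ℕ → ℝ}
    (h0 : ∀ k, |S.β0 (k + 1) - S.β0 k| ≤ σ0 k)
    (h1 : ∀ k (w : Fin (k + 2) → ℝ), w ∈ Box γ (k + 1) → |S.β1 (k + 1) w - S.β1 k (Fin.tail w)| ≤ σ1 k)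
    (hBbox : ∀ i, i ≤ K + 1 → 0 < gB i ∧ gB i ≤ γ) :
    (∀ j, j < K → |β (j + 1) (prefixOf gB (j + 1)) - β j (Fin.tail (prefixOf gB (j + 1)))| ≤ σ0 j + σ1 j) ∧
    (Summable σ0 → Summable σ1 → Summable (fun j => σ0 j + σ1 j)) := by
  refine ⟨fun j hj => ?_, fun hs0 hs1 => hs0.add hs1⟩
  have hw : prefixOf gB (j + 1) ∈ Box γ (j + 1) := T4CouplingMatching.prefixOf_mem_box (N := K + 1) (by omega) hBbox
  exact (shift_le_of_split S j (prefixOf gB (j + 1))).trans (add_le_add (h0 j) (h1 j _ hw))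

/-! ## §4 The tree's geometric currency is the special case `σ_j = c·θ^j` -/

/-- GEOMETRIC ⊂ ℓ¹ AT THE SUPPLIER LEVEL: the tree's `ScaleShiftRate c θ γ β` (`0 ≤ θ < 1`) gives, along every run `g^B` in the box, the along-run
shift bound with the SUMMABLE profile `σ_j = c·θ^j` — so every producer of the tree's node-U2 input feeds the ℓ¹ road unchanged, and the ℓ¹ road
accepts strictly more (any summable profile). [folklore] -/
theorem shiftAlong_of_scaleShiftRate {β : HBeta} {c θ γ : ℝ} {K : ℕ} {gB : ℕ → ℝ} (hS : T4CouplingMatching.ScaleShiftRate c θ γ β)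
    (hθ0 : 0 ≤ θ) (hθ1 : θ < 1) (hBbox : ∀ i, i ≤ K + 1 → 0 < gB i ∧ gB i ≤ γ) :
    (∀ j, j < K → |β (j + 1) (prefixOf gB (j + 1)) - β j (Fin.tail (prefixOf gB (j + 1)))| ≤ c * θ ^ j) ∧
    Summable (fun j => c * θ ^ j) :=
  ⟨fun j hj => hS j _ (T4CouplingMatching.prefixOf_mem_box (N := K + 1) (by omega) hBbox),
    (summable_geometric_of_lt_one hθ0 hθ1).mul_left c⟩

/-- Likewise for the remainder: `RemainderShiftRate S c₁ θ γ` (`0 ≤ θ < 1`) is the box bound of §3 with the summable profile `σ¹_k = c₁·θ^k`.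
[folklore] -/
theorem remainderShift_l1_of_rate {β : HBeta} {S : B12Beta.OneLoopSplit β} {c₁ θ γ : ℝ}
    (hR : T4CouplingMatching.RemainderShiftRate S c₁ θ γ) (hθ0 : 0 ≤ θ) (hθ1 : θ < 1) :
    (∀ k (w : Fin (k + 2) → ℝ), w ∈ Box γ (k + 1) → |S.β1 (k + 1) w - S.β1 k (Fin.tail w)| ≤ c₁ * θ ^ k) ∧
    Summable (fun k => c₁ * θ ^ k) :=
  ⟨hR, (summable_geometric_of_lt_one hθ0 hθ1).mul_left c₁⟩

end Summit.QuantumFields.BalabanUV.T4Continuum.NE7MarginalL1Supply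

end
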